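/-
Copyright: cell pub-balaban-gaps (YM BLITZ Y1, track G1), seat g1-p2 GEN 8 (unit `pub-balaban-gaps-g1-p2`).  Row (D4) NODE O,
OBJECT ∕ MECHANISM level, CARRIER-GENERIC (sequel of `D4WalkBlockShiftAlgebra`): FAITHFULNESS of the (3.52)-structured covariant
shift — `Δ_1 ⊗ 1 − Δ_W = V_W` for [B9] (3.50)'s covariant Laplacian with transport defects — and [B9] COR. 3.5's STEP for `V_W` on
ANY kernel carrying a value letter and forward-derivative letters in the (D4) block currency (backward letters by one-cube
relabelling), over any finite carrier with shift permutations.  HONEST FRAMING: elementary; nothing of Bałaban's `U′ = e^{iηA}` ∕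
`V′(A)` constructed; (D4) NOT discharged (instance 0∕1); NOT BetaPertH, NOT continuum, NOT Clay.
-/
import Summits.QuantumFields.BalabanUV.Gaps.D4WalkBlockShiftAlgebra

/-!
# `Gaps.D4WalkBlockShiftStep` — faithfulness `Δ_1 ⊗ 1 − Δ_W = V_W` and [B9] Cor. 3.5's step for the covariant shift on any
# kernel with letters, carrier-generic (cell pub-balaban-gaps, seat g1-p2 gen 8)

HONEST DEPENDENCY (cell pub-balaban, verbatim): continuum YM on T⁴ ⇐ BetaPertH ∧ nine spine estimates (0/9 proved);
BetaPertH ⇐ (D1) ∧ (D4) ∧ CAP+tail.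

* §1 faithfulness: `covLap` ((3.50) at `U = 1` with defects `W^±_μ`), `flatLap` (all defects zero), `Sfw_eq` (`S_μ ⊗ 1 = 1 + η(∂_μ ⊗ 1)`),
  `Sbw_mul_Sfw` (`S⁻S = 1`), `Sbw_eq`, **`flatLap_sub_covLap`** (`Δ_1 ⊗ 1 − Δ_W = V_W`, `η ≠ 0`) — 59b's §5 over any carrier;
* §2 **`blockWalkExpansion_covShift_of_letters`** — [B9] COR. 3.5's STEP FOR THE COVARIANT SHIFT ON ANY KERNEL `G` with the value
  letter `‖G‖_{Y,Y′} ≤ Ce^{−ρd₁}` and the forward derivative letters `‖(∂_μ ⊗ 1)G‖_{Y,Y′} ≤ Ce^{−ρd₁}` (`C, ρ ≥ 0`), shifts whose inverses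
  move the cube by at most one, `η > 0`: for holomorphic defect families with the BOND window `ηα` and the DIVERGENCE window `η²α′`,
  every cube row sum `(μ, c_μ)`, `2μ ≤ ε`, `2μ ≤ ρ − ε − μ`, margin `c_μ(c_μ·1·(1·((α′ + Σ_ι α·covB ρ ι)C))c_μ)c_μ < 1`:
  `G(1 − V_W(u)G)⁻¹` is a block walk expansion at `(ε − 2μ, ρ − ε − 3μ, c_μC(1·(1−q)⁻¹)c_μ, ρ − 2μ)` with the relative derivative
  letters `covB ρ` and dominating distances — 59b's END with the flat letters as HYPOTHESES (instances: the one-scale torus family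
  via 58, the nested family of junction J-3 via `D4WalkBlockFlatFibreMultiLevel` in `D4WalkBlockCovariantShiftMultiLevel`).
WHAT IT IS NOT.  The windows from (3.37) for `U′ = e^{iηA}`; the averaging corrections `F′₂`; (D4) instance 0∕1; words UNCHANGED.

References: T. Bałaban, Comm. Math. Phys. **99** (1985) 389–434 [B9], (3.23) p. 394, (3.50)–(3.54) pp. 400–401, (3.60)–(3.65)
pp. 402–403, Cor. 3.5 p. 407; Comm. Math. Phys. **116** (1988) [II], (1.11) p. 5.
-/

noncomputable section

namespace Summit.QuantumFields.BalabanUV.Gaps.D4WalkBlockShiftStep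

open Metric Set Finset
open scoped Matrix
open Literature.MathematicalPhysics.QuantumFieldTheory.Balaban1983to89
open Literature.MathematicalPhysics.QuantumFieldTheory.Balaban1983to89.B9SectDWalk (DomBy)
open Literature.MathematicalPhysics.QuantumFieldTheory.Balaban1983to89.B9Thm34Ext (toB6)
open Literature.MathematicalPhysics.QuantumFieldTheory.Balaban1983to89.B9Thm37GlueTorus (torusGeom tdist1 tdist1_nonneg)
open Literature.MathematicalPhysics.QuantumFieldTheory.Balaban1983to89.TreeLengthTorus (TPt)
open Literature.MathematicalPhysics.QuantumFieldTheory.Balaban1983to89.B5TorusCover (UT)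
open Literature.MathematicalPhysics.QuantumFieldTheory.Balaban1983to89.B11SectG (RowSum)
open Summit.QuantumFields.BalabanUV.Gaps.D4WalkBlock (blockNorm BlockWalkExpansion)
open Summit.QuantumFields.BalabanUV.Gaps.D4WalkBlockDerivative (blockWalkExpansion_perturb_of_derivLetters)
open Summit.QuantumFields.BalabanUV.Gaps.D4WalkBlockFlatLetters (blockWalkExpansion_const)
open Summit.QuantumFields.BalabanUV.Gaps.D4WalkBlockShiftAlgebra

variable {X : Type} {F : Type}
variable {ν : ℕ} {Kv : Fin ν → ℕ}

/-! ## §1. Faithfulness: `covShift = Δ_1 ⊗ 1 − Δ_W` for the covariant Laplacian (3.50) with defects -/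

section Faithful
variable (X F) [Fintype X] [Fintype F] [DecidableEq X] [DecidableEq F] {ι : Type} [Fintype ι] (sh : ι → X ≃ X) (η : ℝ)
variable {E : Type*} [NormedAddCommGroup E] [NormedSpace ℂ E]
variable (Wp Wm : ι → E → X → Matrix F F ℂ)

/-- **THE COVARIANT LAPLACIAN WITH TRANSPORT DEFECTS** — (3.50) at `U = 1` with `R(U′_b) = 1 + W_b`:
`(Δ_Wλ)(x) = η⁻²Σ_μ(2λ(x) − (1 + W⁺_μ(x))λ(x + e_μ) − (1 + W⁻_μ(x))λ(x − e_μ))`. [cite: Balaban1985BackgroundPropagators, (3.50) p.400, (3.23) p.394] -/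
def covLap (u : E) : Matrix (X × F) (X × F) ℂ :=
  (((η : ℂ)⁻¹) ^ 2) • ∑ μ, ((2 : ℂ) • (1 : Matrix (X × F) (X × F) ℂ) -
    (1 + fibD X F (Wp μ u)) * Sfw X F sh μ - (1 + fibD X F (Wm μ u)) * Sbw X F sh μ)

/-- The flat fibred Laplacian `Δ_1 ⊗ 1 = η⁻²Σ_μ(2 − S_μ − S⁻_μ)` (all defects zero). [cite: Balaban1985BackgroundPropagators, (3.23) p.394] -/
def flatLap : Matrix (X × F) (X × F) ℂ :=
  (((η : ℂ)⁻¹) ^ 2) • ∑ μ : ι, ((2 : ℂ) • (1 : Matrix (X × F) (X × F) ℂ) - Sfw X F sh μ - Sbw X F sh μ)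

variable {X F sh η Wp Wm}

omit [Fintype X] [Fintype F] [Fintype ι] in
/-- **`S_μ ⊗ 1 = 1 + η(∂_μ ⊗ 1)`** (the definition of `Dfw`, solved for the shift; `η ≠ 0`). -/
theorem Sfw_eq (hη : η ≠ 0) (μ : ι) : Sfw X F sh μ = 1 + (η : ℂ) • Dfw X F sh η μ := by
  have hη' : (η : ℂ) ≠ 0 := by exact_mod_cast hη
  unfold Dfw
  rw [smul_smul, mul_inv_cancel₀ hη', one_smul, add_sub_cancel]

omit [Fintype ι] in
/-- **`S⁻_μS_μ = 1`** (`(x − e_μ) + e_μ = x`). -/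
theorem Sbw_mul_Sfw (μ : ι) : Sbw X F sh μ * Sfw X F sh μ = 1 := by
  unfold Sbw Sfw
  rw [relab_mul_relab]
  have e : ((sh μ : X → X) ∘ ((sh μ).symm : X → X)) = id := by funext x; simp
  rw [e, relab_id]

omit [Fintype ι] in
/-- **`S⁻_μ = 1 − ηS⁻_μ(∂_μ ⊗ 1)`**. -/
theorem Sbw_eq (hη : η ≠ 0) (μ : ι) : Sbw X F sh μ = 1 - (η : ℂ) • (Sbw X F sh μ * Dfw X F sh η μ) := by
  have h := Sbw_mul_Sfw (X := X) (F := F) (sh := sh) μ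
  rw [Sfw_eq hη, Matrix.mul_add, Matrix.mul_one, Matrix.mul_smul] at h
  rw [eq_sub_iff_add_eq]; exact h

omit [NormedAddCommGroup E] [NormedSpace ℂ E] in
/-- **FAITHFULNESS — `Δ_1 ⊗ 1 − Δ_W = V_W`**: the structured `covShift` IS the perturbation of (3.50)'s covariant Laplacian with
defects. [cite: Balaban1985BackgroundPropagators, (3.50)–(3.53) pp.400–401] -/
theorem flatLap_sub_covLap (hη : η ≠ 0) (u : E) :
    flatLap X F sh η - covLap X F sh η Wp Wm u = covShift X F sh η Wp Wm u := by
  have hη' : (η : ℂ) ≠ 0 := by exact_mod_cast hη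
  have h1 : flatLap X F sh η - covLap X F sh η Wp Wm u =
      (((η : ℂ)⁻¹) ^ 2) • ∑ μ, (fibD X F (Wp μ u) * Sfw X F sh μ + fibD X F (Wm μ u) * Sbw X F sh μ) := by
    unfold flatLap covLap
    rw [← smul_sub, ← Finset.sum_sub_distrib]
    congr 1
    refine Finset.sum_congr rfl fun μ _ => ?_
    noncomm_ring
  rw [h1]
  have h2 : ∀ μ, fibD X F (Wp μ u) * Sfw X F sh μ + fibD X F (Wm μ u) * Sbw X F sh μ =
      (fibD X F (Wp μ u) + fibD X F (Wm μ u)) + (η : ℂ) • (fibD X F (Wp μ u) * Dfw X F sh η μ) -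
        (η : ℂ) • (fibD X F (Wm μ u) * (Sbw X F sh μ * Dfw X F sh η μ)) := by
    intro μ
    conv_lhs => rw [Sfw_eq (X := X) (F := F) (sh := sh) hη μ, Sbw_eq (X := X) (F := F) (sh := sh) hη μ]
    rw [Matrix.mul_add, Matrix.mul_one, Matrix.mul_smul, Matrix.mul_sub, Matrix.mul_one, Matrix.mul_smul]
    abel
  simp_rw [h2]
  unfold covShift covCoeff₀
  rw [Fintype.sum_sum_type]
  simp only [covCoeff, covDop]
  rw [fibD_smul, fibD_sum]
  simp only [fibD_add, fibD_smul]
  rw [Finset.sum_sub_distrib, Finset.sum_add_distrib, smul_sub, smul_add, Finset.smul_sum, Finset.smul_sum,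
    Finset.smul_sum]
  have e3 : ∀ μ, (((η : ℂ)⁻¹) ^ 2) • ((η : ℂ) • (fibD X F (Wp μ u) * Dfw X F sh η μ)) =
      (((η : ℂ)⁻¹) • fibD X F (Wp μ u)) * Dfw X F sh η μ := fun μ => by
    rw [smul_smul, Matrix.smul_mul, pow_two, mul_assoc, inv_mul_cancel₀ hη', mul_one]
  have e4 : ∀ μ, (((η : ℂ)⁻¹) ^ 2) • ((η : ℂ) • (fibD X F (Wm μ u) * (Sbw X F sh μ * Dfw X F sh η μ))) =
      -(((-((η : ℂ)⁻¹)) • fibD X F (Wm μ u)) * (Sbw X F sh μ * Dfw X F sh η μ)) := fun μ => by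
    rw [smul_smul, Matrix.smul_mul, neg_smul, neg_neg, pow_two, mul_assoc, inv_mul_cancel₀ hη', mul_one]
  simp_rw [e3, e4, Finset.sum_neg_distrib, sub_neg_eq_add, ← Finset.smul_sum]
  abel

end Faithful

/-! ## §2. [B9] Cor. 3.5's step for the covariant shift on any kernel with value + forward-derivative letters -/

section Step
variable [Fintype X] [Fintype F] [DecidableEq X] [DecidableEq F] {ι : Type} [Fintype ι] {sh : ι → X ≃ X} {η : ℝ}
variable [∀ i, NeZero (Kv i)]
variable {dd N' : ℕ} {E : Type*} [NormedAddCommGroup E] [NormedSpace ℂ E]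

/-- **[B9] COR. 3.5's STEP FOR THE COVARIANT SHIFT ON ANY KERNEL WITH LETTERS.**  Data: a cube map `cub`, shifts `sh μ` whose INVERSES
move the cube by at most one, a scale `η > 0`, a kernel `G` on `X × F` with the VALUE letter `‖G‖_{Y,Y′} ≤ Ce^{−ρd₁(Y,Y′)}` and the FORWARD
DERIVATIVE letters `‖(∂_μ ⊗ 1)G‖_{Y,Y′} ≤ Ce^{−ρd₁(Y,Y′)}` (`C, ρ ≥ 0`).  Then for every holomorphic defect family with the BOND window
`ηα` and the DIVERGENCE window `η²α′`, every cube row sum `(μ, c_μ)`, rates `0 ≤ μ`, `2μ ≤ ε`, `2μ ≤ ρ − ε − μ`, and the MARGIN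
`c_μ(c_μ·1·(1·((α′ + Σ_ι α·covB ρ ι)C))c_μ)c_μ < 1`: `G(1 − V_W(u)G)⁻¹` is a block walk expansion at `(ε − 2μ, ρ − ε − 3μ,
c_μC(1·(1−q)⁻¹)c_μ, ρ − 2μ)` with the relative derivative letters `covB ρ` (backward ones relabelled: `blockNorm_relab_mul_le`) and
dominating distances — no constant depends on the carrier, `η⁻¹` or the fibre.
[cite: Balaban1985BackgroundPropagators, Cor. 3.5 p.407, (3.50)–(3.54) pp.400–401, (3.60)–(3.64) p.402; Balaban1988RG2Cluster, (1.11) p.5] -/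
theorem blockWalkExpansion_covShift_of_letters (cub : X → UT Kv) (hη : 0 < η)
    (hsh : ∀ μ x, tdist1 Kv (cub ((sh μ).symm x)) (cub x) ≤ 1) (G : Matrix (X × F) (X × F) ℂ) {C ρ : ℝ} (hC : 0 ≤ C)
    (hρ : 0 ≤ ρ)
    (hG : ∀ Y Y', blockNorm (fun p : X × F => cub p.1) (fun p : X × F => cub p.1) G Y Y' ≤ C * Real.exp (-(ρ * tdist1 Kv Y Y')))
    (hDG : ∀ μ Y Y', blockNorm (fun p : X × F => cub p.1) (fun p : X × F => cub p.1) (Dfw X F sh η μ * G) Y Y' ≤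
      C * Real.exp (-(ρ * tdist1 Kv Y Y')))
    (c₀ : B13.Consts) (Xs : Finset (UT Kv)) (R : ℝ) (Wp Wm : ι → E → X → Matrix F F ℂ) (α α' ε μ cμ : ℝ)
    (hWph : ∀ ν x a b, DifferentiableOn ℂ (fun u => Wp ν u x a b) (ball (0 : E) R))
    (hWmh : ∀ ν x a b, DifferentiableOn ℂ (fun u => Wm ν u x a b) (ball (0 : E) R)) (hα : 0 ≤ α) (hα' : 0 ≤ α')
    (hWp : ∀ ν, ∀ u ∈ ball (0 : E) R, ∀ x a, ∑ b, ‖Wp ν u x a b‖ ≤ η * α)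
    (hWm : ∀ ν, ∀ u ∈ ball (0 : E) R, ∀ x a, ∑ b, ‖Wm ν u x a b‖ ≤ η * α)
    (hdiv : ∀ u ∈ ball (0 : E) R, ∀ x a, ∑ b, ‖(∑ ν, (Wp ν u x + Wm ν u x)) a b‖ ≤ η ^ 2 * α')
    (hμ : 0 ≤ μ) (hμε : 2 * μ ≤ ε) (hμκ : 2 * μ ≤ ρ - ε - μ) (hcμ : 0 ≤ cμ)
    (hrow : RowSum (toB6 (torusGeom Kv 0 0 0) 0 True) μ cμ)
    (hq : cμ * (cμ * 1 * (1 * ((α' + ∑ j : ι ⊕ ι, α * covB ρ j) * C)) * cμ) * cμ < 1) :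
    ∃ (W : Type) (T : W → (TPt dd N' → ℂ) → E → Matrix (X × F) (X × F) ℂ) (SX' : Set W) (A' : W → ℝ)
      (D' : W → UT Kv → UT Kv → ℝ),
      BlockWalkExpansion c₀ (fun p : X × F => cub p.1) (fun p : X × F => cub p.1)
        (fun (_ : TPt dd N' → ℂ) u => G * (1 - covShift X F sh η Wp Wm u * G)⁻¹) Xs R (ε - 2 * μ) (ρ - ε - μ - 2 * μ)
        (cμ * C * (1 * (1 - cμ * (cμ * 1 * (1 * ((α' + ∑ j : ι ⊕ ι, α * covB ρ j) * C)) * cμ) * cμ)⁻¹) * cμ)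
        T SX' A' D' (ρ - 2 * μ) ∧
      (∀ (j : ι ⊕ ι) ω (σ : TPt dd N' → ℂ), (∀ i, ‖σ i‖ ≤ Real.exp c₀.κ₁) → ∀ u ∈ ball (0 : E) R, ∀ Y Y',
        blockNorm (fun p : X × F => cub p.1) (fun p : X × F => cub p.1) (covDop X F sh η j * T ω σ u) Y Y' ≤
          covB (ι := ι) ρ j * (A' ω * Real.exp (-((ρ - 2 * μ) * D' ω Y Y')))) ∧
      ∀ ω, DomBy (toB6 (torusGeom Kv 0 0 0) 0 True) (D' ω) := by
  -- the kernel as a one-term expansion at walk rate ρ, window ε, torus rate ρ − ε − μ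
  have hW := blockWalkExpansion_const (dd := dd) (N' := N') (E := E) c₀ (fun p : X × F => cub p.1) Xs G R
    (ε := ε) (κ := ρ - ε - μ) (ρ := ρ) hC (by linarith) hG
  -- derivative letters: forward (B = 1) by hypothesis, backward-relabelled (B = e^{ρ}) by §2
  have hD : ∀ (j : ι ⊕ ι) (ω : Unit) (σ : TPt dd N' → ℂ), (∀ i, ‖σ i‖ ≤ Real.exp c₀.κ₁) → ∀ u ∈ ball (0 : E) R,
      ∀ Y Y' : UT Kv,
        blockNorm (fun p : X × F => cub p.1) (fun p : X × F => cub p.1) (covDop X F sh η j * G) Y Y' ≤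
          covB (ι := ι) ρ j * (C * Real.exp (-(ρ * tdist1 Kv Y Y'))) := by
    intro j _ σ _ u _ Y Y'
    cases j with
    | inl ν =>
        show blockNorm _ _ (Dfw X F sh η ν * G) Y Y' ≤ 1 * _
        rw [one_mul]; exact hDG ν Y Y'
    | inr ν =>
        show blockNorm _ _ (Sbw X F sh ν * Dfw X F sh η ν * G) Y Y' ≤ Real.exp ρ * _
        rw [Matrix.mul_assoc]
        have h := blockNorm_relab_mul_le (F := F) cub ((sh ν).symm : X → X) (hsh ν) (Dfw X F sh η ν * G) hC hρ
          (fun Y Y' => hDG ν Y Y') Y Y'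
        calc _ ≤ _ := h
          _ = _ := by ring
  exact blockWalkExpansion_perturb_of_derivLetters (Dop := covDop X F sh η) (B := covB (ι := ι) ρ) hW (fun _ Y Y' => le_rfl)
    (fun j => by cases j <;> simp only [covB] <;> positivity) hD (covShift_holo hWph hWmh) hα' (fun _ => hα)
    (covShift_dominated cub hη hα hα' hWp hWm hdiv) hμ hμε hμκ (by linarith) hC hcμ hrow hq

end Step

end Summit.QuantumFields.BalabanUV.Gaps.D4WalkBlockShiftStep

end
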